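import Summits.Ventures.PackingBounds.Configurations.AlgebraicListConfig

/-!
# Exact algebraic spherical codes: the row/pair certificates checked in RANGES (split across files)

Framing: lottery ticket; floor = certified bounds/negative ranges. Venture `PackingBounds` (cell `pub-packcert`, seat
`pub-packcert-recog`, RECOG.md v35 §26 ALG-GRAM / v37 §27 ALG-HIGH). `AlgebraicListConfig.exists_code_alg` takes ONE
Boolean `rowsOK` over the whole `|L| × |L|` table of pair certificates, so a data file must hold every certificate and
elaborate one `decide`; for larger objects (e.g. the `51`-point code of `ℝ¹²` over a quintic field: 1.5 MB of
certificates) this exceeds the gate's per-file size cap. This file re-expresses the SAME checks row by row: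
`rowOK … L i nc pcs` = the norm certificate of row `i` and the pair certificates of row `i` against every other row
(the same `normOK` / `pairOK` programs), `rangeOK … L i0 NC PC` = `rowOK` for the consecutive rows
`i0, …, i0 + |NC| − 1`, and `coverOK m R` = the ranges `R` cover `[0, m)`. The packaging theorem
`exists_code_alg_rows` has the conclusion of `exists_code_alg` VERBATIM and the hypothesis
`∀ i < |L|, ∃ nc pcs, rowOK … L i nc pcs = true` in place of `rowsOK … = true`; `rows_of_ranges` assembles that
hypothesis from finitely many `rangeOK` facts (each provable by `decide` in its own file) and one `coverOK` fact.
No new mathematics: the per-row unpacking lemmas of `AlgebraicListConfig` (`dot_self_of_normOK`, `dot_le_of_pairOK`,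
`norm_avec`, `inner_avec`, …) are reused unchanged; `rowsOK_iff_rows` records that the unsplit check is the special
case of one range.
-/

namespace Summit.Ventures.PackingBounds.Config.AlgWeighted

open Finset WithLp Set

/-- Row check `i`: the norm certificate `nc` of row `i` and, for every `j ≠ i`, the pair certificate `pcs[j]` of
rows `i`, `j` (same programs `normOK` / `pairOK` as `rowsOK`). -/
def rowOK (P : List ℤ) (a b : ℤ) (D : ℕ) (W : List (List ℤ)) (q : ℤ) (Snum : List ℤ) (sden : ℕ)
    (L : List (List (List ℤ))) (i : ℕ) (nc : ℤ × List ℤ) (pcs : List (ℤ × List ℤ)) : Bool :=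
  normOK P W q (L.getD i []) nc &&
    (List.range L.length).all fun j =>
      (i == j) || pairOK P a b D W q Snum sden (L.getD i []) (L.getD j []) (pcs.getD j (0, []))

/-- Range check: rows `i0, …, i0 + |NC| − 1`, row `i0 + k` with certificates `NC[k]`, `PC[k]`. -/
def rangeOK (P : List ℤ) (a b : ℤ) (D : ℕ) (W : List (List ℤ)) (q : ℤ) (Snum : List ℤ) (sden : ℕ)
    (L : List (List (List ℤ))) (i0 : ℕ) (NC : List (ℤ × List ℤ)) (PC : List (List (ℤ × List ℤ))) : Bool :=
  (List.range NC.length).all fun k =>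
    rowOK P a b D W q Snum sden L (i0 + k) (NC.getD k (0, [])) (PC.getD k [])

/-- The ranges `R = [(i0, cnt), …]` cover `[0, m)`. -/
def coverOK (m : ℕ) (R : List (ℕ × ℕ)) : Bool :=
  (List.range m).all fun i => R.any fun r => decide (r.1 ≤ i) && decide (i < r.1 + r.2)

variable {α : ℝ} {n : ℕ} {q : ℤ} {W : List (List ℤ)}

/-- Unpacking `rangeOK`: every row of the range passes `rowOK` with some certificates. -/
theorem rowOK_of_rangeOK {P : List ℤ} {a b : ℤ} {D : ℕ} {Snum : List ℤ} {sden : ℕ}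
    {L : List (List (List ℤ))} {i0 : ℕ} {NC : List (ℤ × List ℤ)} {PC : List (List (ℤ × List ℤ))}
    (h : rangeOK P a b D W q Snum sden L i0 NC PC = true) {i : ℕ} (h1 : i0 ≤ i) (h2 : i < i0 + NC.length) :
    ∃ nc pcs, rowOK P a b D W q Snum sden L i nc pcs = true := by
  simp only [rangeOK, List.all_eq_true, List.mem_range] at h
  obtain ⟨k, rfl⟩ := Nat.exists_eq_add_of_le h1
  exact ⟨_, _, h k (by omega)⟩

/-- Assembling the per-row hypothesis of `exists_code_alg_rows` from range checks covering `[0, |L|)`. -/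
theorem rows_of_ranges {P : List ℤ} {a b : ℤ} {D : ℕ} {Snum : List ℤ} {sden : ℕ}
    {L : List (List (List ℤ))} (R : List (ℕ × ℕ)) (hc : coverOK L.length R = true)
    (hR : ∀ r ∈ R, ∃ NC PC, NC.length = r.2 ∧ rangeOK P a b D W q Snum sden L r.1 NC PC = true) :
    ∀ i, i < L.length → ∃ nc pcs, rowOK P a b D W q Snum sden L i nc pcs = true := by
  intro i hi
  simp only [coverOK, List.all_eq_true, List.mem_range, List.any_eq_true, Bool.and_eq_true,
    decide_eq_true_eq] at hc
  obtain ⟨r, hr, hr1, hr2⟩ := hc i hi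
  obtain ⟨NC, PC, hlen, hrg⟩ := hR r hr
  exact rowOK_of_rangeOK hrg hr1 (by omega)

/-- The unsplit table check of `AlgebraicListConfig` gives the per-row hypothesis (one range `[0, |L|)`). -/
theorem rows_of_rowsOK {P : List ℤ} {a b : ℤ} {D : ℕ} {Snum : List ℤ} {sden : ℕ}
    {L : List (List (List ℤ))} {NC : List (ℤ × List ℤ)} {PC : List (List (ℤ × List ℤ))}
    (h : rowsOK P a b D W q Snum sden L NC PC = true) :
    ∀ i, i < L.length → ∃ nc pcs, rowOK P a b D W q Snum sden L i nc pcs = true := by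
  intro i hi
  simp only [rowsOK, List.all_eq_true, List.mem_range, Bool.and_eq_true] at h
  refine ⟨NC.getD i (0, []), PC.getD i [], ?_⟩
  simp only [rowOK, Bool.and_eq_true, List.all_eq_true, List.mem_range]
  exact ⟨(h i hi).1, fun j hj => (h i hi).2 j hj⟩

/-- **Packaging (row-wise).** Same conclusion as `exists_code_alg`; the table hypothesis `rowsOK … = true` is
replaced by one `rowOK` fact per row (certificates may come from different files). -/
theorem exists_code_alg_rows {P : List ℤ} {a b : ℤ} {D : ℕ} {W : List (List ℤ)} {L : List (List (List ℤ))}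
    {q : ℤ} {Snum : List ℤ} {sden : ℕ} {n : ℕ} (hF : fieldOK P a b D = true) (hq : 0 < q)
    (hWk : weightsOK a b D W = true) (hS : shapeA W L n = true)
    (hR : ∀ i, i < L.length → ∃ nc pcs, rowOK P a b D W q Snum sden L i nc pcs = true)
    (hB : boundOK a b D Snum sden = true) :
    ∃ α : ℝ, (a : ℝ) / D ≤ α ∧ α ≤ (b : ℝ) / D ∧ leval α P = 0 ∧
      ∃ C : Finset (EuclideanSpace ℝ (Fin n)), C.card = L.length ∧ (∀ x ∈ C, ‖x‖ = 1) ∧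
        ∀ x ∈ C, ∀ y ∈ C, x ≠ y → inner ℝ x y ≤ leval α Snum / sden := by
  obtain ⟨α, h1, h2, hP⟩ := exists_root P a b D hF
  have hD : 0 < D := by
    simp only [fieldOK, Bool.and_eq_true, decide_eq_true_eq] at hF; exact hF.1.1.1
  have hDr : (0 : ℝ) < D := by exact_mod_cast hD
  have ha : (a : ℝ) ≤ D * α := by rw [div_le_iff₀ hDr] at h1; linarith
  have hb : (D : ℝ) * α ≤ b := by rw [le_div_iff₀ hDr] at h2; linarith
  have hqr : (0 : ℝ) < q := by exact_mod_cast hq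
  have hWnn := weights_nonneg (α := α) (W := W) hD ha hb hWk
  have hWl := wlength_of_shapeA hS
  simp only [boundOK, Bool.and_eq_true, decide_eq_true_eq] at hB
  obtain ⟨hsden, hs1⟩ := hB
  have hs1' := leval_neg_of_ihz a b D hD α ha hb _ hs1
  simp only [leval_lsub, leval_cons, leval_nil, mul_zero, add_zero, Int.cast_natCast] at hs1'
  have hsdr : (0 : ℝ) < sden := by exact_mod_cast hsden
  have hrow : ∀ i, i < L.length →
      (∃ nc, normOK P W q (L.getD i []) nc = true) ∧
        ∀ j, j < L.length → i ≠ j →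
          ∃ cu, pairOK P a b D W q Snum sden (L.getD i []) (L.getD j []) cu = true := by
    intro i hi
    obtain ⟨nc, pcs, h⟩ := hR i hi
    simp only [rowOK, Bool.and_eq_true, List.all_eq_true, List.mem_range, Bool.or_eq_true,
      beq_iff_eq] at h
    exact ⟨⟨nc, h.1⟩, fun j hj hij => ⟨_, (h.2 j hj).resolve_left hij⟩⟩
  set pt : ℕ → EuclideanSpace ℝ (Fin n) := fun i => avec α n q W (L.getD i []) with hpt
  have hnorm : ∀ i, i < L.length → ‖pt i‖ = 1 := by
    intro i hi
    obtain ⟨nc, hnc⟩ := (hrow i hi).1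
    exact norm_avec α n q W hqr hWl hWnn _ (length_of_shapeA hS hi) (dot_self_of_normOK hP hnc)
  have hinner : ∀ i, i < L.length → ∀ j, j < L.length → i ≠ j →
      inner ℝ (pt i) (pt j) ≤ leval α Snum / sden := by
    intro i hi j hj hij
    obtain ⟨cu, hp⟩ := (hrow i hi).2 j hj hij
    have hle := dot_le_of_pairOK (q := q) hD ha hb hP hp
    rw [hpt, inner_avec α n q W hqr hWl hWnn _ _ (length_of_shapeA hS hi) (length_of_shapeA hS hj),
      div_le_div_iff₀ hqr hsdr]
    linarith
  have hinj : ∀ i, i < L.length → ∀ j, j < L.length → pt i = pt j → i = j := by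
    intro i hi j hj he
    by_contra hij
    have h := hinner i hi j hj hij
    rw [he, real_inner_self_eq_norm_sq, hnorm j hj, one_pow] at h
    have : leval α Snum / sden < 1 := by rw [div_lt_one hsdr]; linarith
    linarith
  refine ⟨α, h1, h2, hP, ((List.range L.length).map pt).toFinset, ?_, ?_, ?_⟩
  · rw [List.toFinset_card_of_nodup, List.length_map, List.length_range]
    exact List.nodup_range.map_on fun i hi j hj he =>
      hinj i (List.mem_range.1 hi) j (List.mem_range.1 hj) he
  · intro x hx
    simp only [List.mem_toFinset, List.mem_map, List.mem_range] at hx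
    obtain ⟨i, hi, rfl⟩ := hx
    exact hnorm i hi
  · intro x hx y hy hxy
    simp only [List.mem_toFinset, List.mem_map, List.mem_range] at hx hy
    obtain ⟨i, hi, rfl⟩ := hx; obtain ⟨j, hj, rfl⟩ := hy
    exact hinner i hi j hj (fun h => hxy (by rw [h]))

/-- Consistency: the unsplit certificate data of `exists_code_alg` also feed `exists_code_alg_rows`. -/
theorem exists_code_alg_of_rowsOK {P : List ℤ} {a b : ℤ} {D : ℕ} {W : List (List ℤ)}
    {L : List (List (List ℤ))} {NC : List (ℤ × List ℤ)} {PC : List (List (ℤ × List ℤ))} {q : ℤ}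
    {Snum : List ℤ} {sden : ℕ} {n : ℕ} (hF : fieldOK P a b D = true) (hq : 0 < q)
    (hWk : weightsOK a b D W = true) (hS : shapeA W L n = true)
    (hR : rowsOK P a b D W q Snum sden L NC PC = true) (hB : boundOK a b D Snum sden = true) :
    ∃ α : ℝ, (a : ℝ) / D ≤ α ∧ α ≤ (b : ℝ) / D ∧ leval α P = 0 ∧
      ∃ C : Finset (EuclideanSpace ℝ (Fin n)), C.card = L.length ∧ (∀ x ∈ C, ‖x‖ = 1) ∧
        ∀ x ∈ C, ∀ y ∈ C, x ≠ y → inner ℝ x y ≤ leval α Snum / sden :=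
  exists_code_alg_rows hF hq hWk hS (rows_of_rowsOK hR) hB

end Summit.Ventures.PackingBounds.Config.AlgWeighted
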